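import Mathlib
import Literature.AlgebraicGeometry.Resolution.TranscendenceDefect
import Summits.ResolutionOfSingularities.ResolutionOfSingularities.Theorems.HomologicalConductorNoZenoBirthDefs
import HarnessLib

/-!
# Route `HomologicalConductor`, support `SurfaceTermination` (stmt-ResolutionOfSingularities-16488):
# the PRIME-DIVISOR special case (D-s), as a named statement

`[OURS · L W4.4]` Cell res-hironaka, crux chain W4.4 (planner res-L0-w44-plan-1, CHAIN v10/v11 «dichotomy
reduction»; prover res-L0-w44-stub-3).  Nothing here is a statement of the manuscript under review
(Hironaka 2017); AI-written, weaker than expert review.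

`PrimeDivisorSurfaceTermination` is the support item `SurfaceTermination`
(`Summit.ResolutionOfSingularities.ResolutionOfSingularities.Theses.HomologicalConductor.SurfaceTermination`,
stmt-16488) VERBATIM — same binders, same inline `let ca / loc / chart / nrm / tower`, same conclusion
`∃ m, IsRegularLocalRing ↥(tower A m)` — with the datum binder `hk : k ⊆ O` NAMED and THREE EXTRA HYPOTHESES
inserted after `ringKrullDim ↥A = 2`:

  `O ≠ ⊤ → IsDiscreteValuationRing ↥O → residueTrdeg k O hk + 1 = Algebra.trdeg k K`,

i.e. the valuation ring `O` is a PRIME DIVISOR of `K/k` (a discrete valuation ring of `K`, `≠ K`, whose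
residue field has transcendence degree `tr.deg_k K − 1 = 1` over `k`; Zariski–Samuel VI §14).  In words:
**along a prime divisor `W` of the function field of a surface, the canonical normalised `ca`-tower of a
two-dimensional affine model `A ⊆ W` reaches a regular local ring** — the centres of `W` on the tower cannot
be singular closed points for ever («Zariski finiteness for the `ca`-tower»).

Role (the companion proof file `…SurfaceTerminationReduction.lean`): modulo the six named facts of the crux's
registered bundle (`stub_publishedSurfaceFacts`), **`SurfaceTermination ↔ PrimeDivisorSurfaceTermination`** —
by the unconditional surface tower dichotomy (`NoZeno.Negative.surfaceTower_dichotomy`: the tower exhausts `O`,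
or a prime divisor skeleton-dominates it and has the same tower) and the sandwiched termination theorem
(`NoZeno.SandwichCluster.sandwichedTermination_of_facts`: an exhausting tower is eventually sandwiched and
terminates).  So (D-s) is the exact residual of the kill test K4.4-s; it replaces «`StrictDrop` on surfaces».
No theorem here; `primeDivisorSurfaceTermination_iff` is the `Iff.rfl` unfolding.

References: O. Zariski, P. Samuel, *Commutative Algebra* II (1960), Ch. VI §14, Thm. 31 [`ZariskiSamuel1960`];
M. Temkin, *Inseparable local uniformization*, J. Algebra 373 (2013), §2.1 (the invariant `F` = `residueTrdeg`)
[`Temkin2013`].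
-/

-- single-problem summit: the doubled namespace component `ResolutionOfSingularities` is forced
set_option linter.dupNamespace false

noncomputable section

namespace Summit.ResolutionOfSingularities.ResolutionOfSingularities.Theorems.SurfaceTermination.Reduction

/-- **(D-s) `PrimeDivisorSurfaceTermination`** — the support item `SurfaceTermination` (stmt-16488) VERBATIM
(binders, inline `let ca / loc / chart / nrm / tower`, conclusion `∃ m, IsRegularLocalRing ↥(tower A m)`), with
`hk : k ⊆ O` named and the three extra hypotheses `O ≠ ⊤ → IsDiscreteValuationRing ↥O →
residueTrdeg k O hk + 1 = Algebra.trdeg k K` («`O` is a prime divisor of `K/k`») inserted after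
`ringKrullDim ↥A = 2`: along a prime divisor of the function field of a surface the canonical normalised
`ca`-tower of a two-dimensional affine model reaches a regular local ring.  OURS (chain W4.4) — a statement
about the route's own tower, NOT a published result and not a statement of the manuscript under review; the
exact residual of `SurfaceTermination` modulo the crux's six named facts (`…SurfaceTerminationReduction`).
(«Prime divisor» in the sense of Zariski–Samuel, Commutative Algebra II, Ch. VI §14.) [this work] -/
def PrimeDivisorSurfaceTermination : Prop :=
  ∀ p : ℕ, p.Prime → ∀ (k K : Type) [Field k] [CharP k p] [Field K] [Algebra k K] (O : ValuationSubring K) (A : Subalgebra k K) (hk : ∀ c : k, algebraMap k K c ∈ O), A.FG → IsFractionRing ↥A K → A.toSubring ≤ O.toSubring → ringKrullDim ↥A = 2 → O ≠ ⊤ → IsDiscreteValuationRing ↥O → Literature.AlgebraicGeometry.Resolution.residueTrdeg k O hk + 1 = Algebra.trdeg k K → let ca : Subalgebra k K → Set K := fun A => {x : K | ∃ hx : x ∈ A, ∃ n : ℕ, ∀ i : ℕ, n ≤ i → ∀ (M N : ModuleCat.{0} ↥A), Module.Finite ↥A M → Module.Finite ↥A N → ∀ e : CategoryTheory.Abelian.Ext.{0}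 M N i, (⟨x, hx⟩ : ↥A) • e = 0}; let loc : Subalgebra k K → Subalgebra k K := fun A => Algebra.adjoin k {y : K | ∃ a ∈ A, ∃ s ∈ A, s⁻¹ ∈ O ∧ y = a * s⁻¹}; let chart : Subalgebra k K → Subalgebra k K := fun A => Algebra.adjoin k ((A : Set K) ∪ {y : K | ∃ c ∈ ca A, ∃ x ∈ ca A, x ≠ 0 ∧ (∀ c' ∈ ca A, c' * x⁻¹ ∈ O) ∧ y = c * x⁻¹}); let nrm : Subalgebra k K → Subalgebra k K := fun B => Algebra.adjoin k {y : K | IsIntegral ↥B y}; let tower : Subalgebra k K → ℕ → Subalgebra k K := fun A m => @Nat.rec (fun _ => Subalgebra k K) (loc A) (fun _ B => loc (nrm (chart B))) m; ∃ m : ℕ, IsRegularLocalRing ↥(tower A m)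

/-- Unfolding of `PrimeDivisorSurfaceTermination` (`Iff.rfl`). [folklore] -/
theorem primeDivisorSurfaceTermination_iff :
    PrimeDivisorSurfaceTermination ↔
      (∀ p : ℕ, p.Prime → ∀ (k K : Type) [Field k] [CharP k p] [Field K] [Algebra k K] (O : ValuationSubring K) (A : Subalgebra k K) (hk : ∀ c : k, algebraMap k K c ∈ O), A.FG → IsFractionRing ↥A K → A.toSubring ≤ O.toSubring → ringKrullDim ↥A = 2 → O ≠ ⊤ → IsDiscreteValuationRing ↥O → Literature.AlgebraicGeometry.Resolution.residueTrdeg k O hk + 1 = Algebra.trdeg k K → let ca : Subalgebra k K → Set K := fun A => {x : K | ∃ hx : x ∈ A, ∃ n : ℕ, ∀ i : ℕ, n ≤ i → ∀ (M N : ModuleCat.{0} ↥A), Module.Finite ↥A M → Module.Finite ↥A N → ∀ e : CategoryTheory.Abelian.Ext.{0} M N i, (⟨x, hx⟩ : ↥A) • e = 0}; let loc : Subalgebra k K → Subalgebra k K := fun A => Algebra.adjoin k {y : K | ∃ a ∈ A, ∃ s ∈ A, s⁻¹ ∈ O ∧ y = a * s⁻¹}; let chart : Subalgebra k K → Subalgebra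 k K := fun A => Algebra.adjoin k ((A : Set K) ∪ {y : K | ∃ c ∈ ca A, ∃ x ∈ ca A, x ≠ 0 ∧ (∀ c' ∈ ca A, c' * x⁻¹ ∈ O) ∧ y = c * x⁻¹}); let nrm : Subalgebra k K → Subalgebra k K := fun B => Algebra.adjoin k {y : K | IsIntegral ↥B y}; let tower : Subalgebra k K → ℕ → Subalgebra k K := fun A m => @Nat.rec (fun _ => Subalgebra k K) (loc A) (fun _ B => loc (nrm (chart B))) m; ∃ m : ℕ, IsRegularLocalRing ↥(tower A m)) :=
  Iff.rfl

/-! ## Appended (rev 2): the named tower form and «exhaustive surface towers terminate»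

The planner's sketch `L/res-L0-w44-plan-1/PrimeDivisorSketch.lean` (sha16 9e40d1426b49fe39; CHAIN v11 note 44 «one Prop,
two consumers») states (D-s) over the NAMED tower `tower O A m` of `Theorems/HomologicalConductorNoZenoBirthDefs.lean`
and adds the Prop `ExhaustiveSurfaceTermination`.  `PrimeDivisorSurfaceTermination` above (rev 1, = K44S-DESCENT §1 (c2)
text: `SurfaceTermination` VERBATIM with inline `let`s) IS that statement DEFINITIONALLY (the named `ca / loc / chart /
nrm / tower` have the route's bodies verbatim): `primeDivisorSurfaceTermination_iff_tower`.  Consumers may use either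
side. -/

/-- **`ExhaustiveSurfaceTermination`** («(c1) as a Prop», the planner's text verbatim): in transcendence degree `2`, a
tower that EXHAUSTS `O` (every element of `O` lies in some stage) reaches a regular stage, for EVERY valuation ring
`O ∋ k` — proved modulo the crux's six named facts in `…SurfaceTerminationReduction.lean` from LU (Cossart–Jannsen–Saito)
+ the LU-sandwich lemma + the sandwich cluster.  OURS; not a statement of the manuscript under review. [this work] -/
def ExhaustiveSurfaceTermination : Prop :=
  ∀ p : ℕ, p.Prime → ∀ (k K : Type) [Field k] [CharP k p] [Field K] [Algebra k K]
    (O : ValuationSubring K) (A : Subalgebra k K), (∀ c : k, algebraMap k K c ∈ O) → A.FG →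
    IsFractionRing ↥A K → A.toSubring ≤ O.toSubring → Algebra.trdeg k K = 2 →
    (∀ x : K, x ∈ O → ∃ m : ℕ, x ∈ Summit.ResolutionOfSingularities.ResolutionOfSingularities.Theorems.NoZeno.Birth.tower O A m) →
    ∃ m : ℕ, IsRegularLocalRing ↥(Summit.ResolutionOfSingularities.ResolutionOfSingularities.Theorems.NoZeno.Birth.tower O A m)

/-- Unfolding of `ExhaustiveSurfaceTermination` (`Iff.rfl`). [folklore] -/
theorem exhaustiveSurfaceTermination_iff :
    ExhaustiveSurfaceTermination ↔
      ∀ p : ℕ, p.Prime → ∀ (k K : Type) [Field k] [CharP k p] [Field K] [Algebra k K]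
        (O : ValuationSubring K) (A : Subalgebra k K), (∀ c : k, algebraMap k K c ∈ O) → A.FG →
        IsFractionRing ↥A K → A.toSubring ≤ O.toSubring → Algebra.trdeg k K = 2 →
        (∀ x : K, x ∈ O → ∃ m : ℕ, x ∈ Summit.ResolutionOfSingularities.ResolutionOfSingularities.Theorems.NoZeno.Birth.tower O A m) →
        ∃ m : ℕ, IsRegularLocalRing ↥(Summit.ResolutionOfSingularities.ResolutionOfSingularities.Theorems.NoZeno.Birth.tower O A m) :=
  Iff.rfl

/-- **(D-s) over the named tower** (the planner's sketch text, CHAIN v11 note 44): `PrimeDivisorSurfaceTermination` —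
`SurfaceTermination` verbatim with inline `let`s, restricted to prime divisors — is DEFINITIONALLY the same statement
with conclusion `∃ m, IsRegularLocalRing ↥(tower O A m)` over the named tower of
`Theorems/HomologicalConductorNoZenoBirthDefs.lean` (whose `ca / loc / chart / nrm / tower` are the route's `let` bodies
verbatim, cf. `NoZeno.Birth.noZeno_iff`). [this work] -/
theorem primeDivisorSurfaceTermination_iff_tower :
    PrimeDivisorSurfaceTermination ↔
      ∀ p : ℕ, p.Prime → ∀ (k K : Type) [Field k] [CharP k p] [Field K] [Algebra k K]
        (O : ValuationSubring K) (A : Subalgebra k K) (hk : ∀ c : k, algebraMap k K c ∈ O), A.FG →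
        IsFractionRing ↥A K → A.toSubring ≤ O.toSubring → ringKrullDim ↥A = 2 →
        O ≠ ⊤ → IsDiscreteValuationRing ↥O → Literature.AlgebraicGeometry.Resolution.residueTrdeg k O hk + 1 = Algebra.trdeg k K →
        ∃ m : ℕ, IsRegularLocalRing ↥(Summit.ResolutionOfSingularities.ResolutionOfSingularities.Theorems.NoZeno.Birth.tower O A m) :=
  Iff.rfl

end Summit.ResolutionOfSingularities.ResolutionOfSingularities.Theorems.SurfaceTermination.Reduction

end
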